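import Summits.MatrixMultiplication.OmegaCensus.STPPVosperSlackTwoCheckersC
import Summits.MatrixMultiplication.OmegaCensus.STPPVosperSlackTwoCheckersSound2
import Summits.MatrixMultiplication.OmegaCensus.STPPVosperSlackTwoShapes
import Summits.MatrixMultiplication.OmegaCensus.STPPVosperSlackTwoSoundReal

/-!
# ω-census (abelian STPP census): tools for the soundness of the slack-2 case-C checker (kernel tool)

HONEST FRAMING (pub-omega census; verbatim): lottery ticket; floor = certified bounds/negative ranges.
Census STRUCTURE (seat pub-omega-stpp-2 gen 27, 2026-08-28), family (b2).  Three pieces factored out of the normal-form soundness proof of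
`caseCDeadQP'` (`STPPVosperSlackTwoSoundC.lean`): `length_le_one_of_nodup_of_forall_eq` (hole logic), `tb_foldl_lor_rot_maskOf` (the sumset mask
`⋁_{s ∈ S} rot (mask X) (p − s)` has bit `v` iff `v` is a value of `(−S) + X` — used for `T = −B₀ + Z°` and `SY = −A₀ + Y°`) with the bound
`foldl_lor_rot_lt_two_pow` and `tb_compl_xor_iff_of_partition` (`free ⊕ tM` means `SY` when `W ⊔ SY ⊔ T = ℤ/p`); the realisation stage is stpp-1's `false_of_realisationsDead`
(`STPPVosperSlackTwoSoundReal.lean`, imported here for the main file).  UNCONDITIONAL; no `decide`.  Nothing here is progress on `ω`.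

References: H. Cohn, R. Kleinberg, B. Szegedy, C. Umans, FOCS 2005 (arXiv:math/0511460), Def. 5.1.
-/

open Finset
open scoped Pointwise

namespace Summit.MatrixMultiplication.OmegaCensus.CubeNB.S2

open Literature.Computability.AlgebraicComplexity
open Literature.Combinatorics.Additive
open Summit.MatrixMultiplication.OmegaCensus.STPPKneser
open Summit.MatrixMultiplication.OmegaCensus.CubeNB.Bits

/-- A duplicate-free list all of whose members are equal has at most one member. [folklore] -/
theorem length_le_one_of_nodup_of_forall_eq {l : List ℕ} (h : l.Nodup) {v : ℕ} (hall : ∀ x ∈ l, x = v) : l.length ≤ 1 := by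
  match l, h, hall with
  | [], _, _ => simp
  | [_], _, _ => simp
  | x :: y :: t, h, hall =>
    exfalso
    have hx := hall x (by simp)
    have hy := hall y (by simp)
    rw [List.nodup_cons] at h
    exact h.1 (by rw [hx, ← hy]; simp)

/-- An `|||`-fold of rotations from an initial value `< 2^p` stays `< 2^p`. [folklore] -/
theorem foldl_lor_rot_lt_two_pow {p M : ℕ} (f : ℕ → ℕ) : ∀ (l : List ℕ) (init : ℕ), init < 2 ^ p →
    l.foldl (fun m q => m ||| rot p M (f q)) init < 2 ^ p
  | [], init, h0 => by simpa using h0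
  | q :: l, init, h0 => by
    rw [List.foldl_cons]; exact foldl_lor_rot_lt_two_pow f l _ (Nat.or_lt_two_pow h0 (rot_lt_two_pow _ _ _))

variable {p : ℕ} [hp : Fact p.Prime]

/-- **Meaning of the sumset mask.**  For value lists `SL` of `S` and `XL` of `X` (finite subsets of `ℤ/p`), the mask `⋁_{s ∈ SL} rot (maskOf XL) (p − s)`
has bit `v` set iff `v` is the value of an element of `(−S) + X`. [folklore] -/
theorem tb_foldl_lor_rot_maskOf {S X : Finset (ZMod p)} {SL XL : List ℕ} (hSL : ∀ v, v ∈ SL ↔ ∃ s ∈ S, s.val = v)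
    (hXL : ∀ v, v ∈ XL ↔ ∃ x ∈ X, x.val = v) (v : ℕ) :
    tb (SL.foldl (fun m q => m ||| rot p (maskOf XL) (p - q)) 0) v = true ↔ ∃ e ∈ S.image (fun s => (0 : ZMod p) - s) + X, e.val = v := by
  have hp0 : 0 < p := hp.out.pos
  have hSlt : ∀ q ∈ SL, q < p := fun q hq => by obtain ⟨s, _, rfl⟩ := (hSL q).1 hq; exact s.val_lt
  have hXlt : ∀ q ∈ XL, q < p := fun q hq => by obtain ⟨x, _, rfl⟩ := (hXL q).1 hq; exact x.val_lt
  have hXM : maskOf XL < 2 ^ p := maskOf_lt_two_pow hXlt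
  constructor
  · intro hv
    have hvp : v < p := by
      by_contra hge
      rw [tb_eq_false_of_lt (foldl_lor_rot_lt_two_pow (fun q => p - q) SL 0 (by positivity)) (by omega)] at hv
      exact Bool.noConfusion hv
    rw [tb_foldl_lor_rot hXM hSlt hvp] at hv
    obtain ⟨q, hq, hqv⟩ := hv
    rw [tb_maskOf] at hqv
    obtain ⟨s, hs, rfl⟩ := (hSL q).1 hq
    obtain ⟨x, hx, hxv⟩ := (hXL _).1 hqv
    have hneg : (0 : ZMod p) - s ∈ S.image (fun s => (0 : ZMod p) - s) := mem_image.2 ⟨s, hs, rfl⟩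
    refine ⟨(0 : ZMod p) - s + x, Finset.add_mem_add hneg hx, ?_⟩
    have hc : ((((v + s.val) % p : ℕ)) : ZMod p) = (v : ZMod p) + s := by rw [cast_add_mod, ZMod.natCast_zmod_val]
    have hxe : x = (v : ZMod p) + s := by
      have := congrArg (fun n : ℕ => (n : ZMod p)) hxv
      simp only [ZMod.natCast_zmod_val, hc] at this; exact this
    rw [hxe, show (0 : ZMod p) - s + ((v : ZMod p) + s) = v by ring, ZMod.val_natCast_of_lt hvp]
  · rintro ⟨e, he, rfl⟩
    rw [Finset.mem_add] at he
    obtain ⟨ns, hns, x, hx, rfl⟩ := he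
    obtain ⟨s, hs, rfl⟩ := mem_image.1 hns
    rw [tb_foldl_lor_rot hXM hSlt (ZMod.val_lt _)]
    refine ⟨s.val, (hSL _).2 ⟨s, hs, rfl⟩, ?_⟩
    rw [tb_maskOf]
    refine (hXL _).2 ⟨x, hx, ?_⟩
    rw [← ZMod.val_add, show (0 : ZMod p) - s + x + s = x by ring]

/-- **`free ⊕ tM` is `SY`.**  If the masks `Mc`, `Mt` have the bit-meanings "value of an element of `W`", "of `T`", and `W ⊔ SY ⊔ T = ℤ/p`
(`W`, `SY` disjoint; `T` disjoint from `W ∪ SY`), then `(fullMask p ⊕ Mc) ⊕ Mt` has the bit-meaning "value of an element of `SY`". [folklore] -/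
theorem tb_compl_xor_iff_of_partition {W SY T : Finset (ZMod p)} {Mc Mt : ℕ}
    (hMc : ∀ v, tb Mc v = true ↔ ∃ e ∈ W, e.val = v) (hMt : ∀ v, tb Mt v = true ↔ ∃ e ∈ T, e.val = v) (hMt_lt : Mt < 2 ^ p)
    (hpart : W ∪ SY ∪ T = univ) (hWSY : Disjoint W SY) (hTWSY : Disjoint T (W ∪ SY)) :
    ∀ v, tb ((fullMask p ^^^ Mc) ^^^ Mt) v = true ↔ ∃ e ∈ SY, e.val = v := by
  have hMc_lt : Mc < 2 ^ p := by
    refine Nat.lt_pow_two_of_testBit _ fun i hi => ?_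
    rw [← tb_eq_testBit, Bool.eq_false_iff]
    intro htb
    obtain ⟨e, _, hev⟩ := (hMc i).1 htb
    have := e.val_lt; omega
  have hM : fullMask p ^^^ Mc < 2 ^ p := by
    rw [fullMask_eq]; exact Nat.xor_lt_two_pow (by have := Nat.one_le_two_pow (n := p); omega) hMc_lt
  have hsy_lt : (fullMask p ^^^ Mc) ^^^ Mt < 2 ^ p := Nat.xor_lt_two_pow hM hMt_lt
  have hSYmem_of : ∀ e : ZMod p, e ∉ W → e ∉ T → e ∈ SY := by
    intro e hW' hT'
    have : e ∈ W ∪ SY ∪ T := by rw [hpart]; exact mem_univ _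
    rcases mem_union.1 this with h' | h'
    · rcases mem_union.1 h' with h'' | h''
      · exact absurd h'' hW'
      · exact h''
    · exact absurd h' hT'
  intro v
  by_cases hvp : v < p
  · have hxor : tb ((fullMask p ^^^ Mc) ^^^ Mt) v = ((!(tb Mc v)) ^^ tb Mt v) := by rw [tb_xor, tb_compl hvp]
    rw [hxor]
    constructor
    · intro hv'
      cases hcv : tb Mc v
      · cases htv : tb Mt v
        · refine ⟨(v : ZMod p), hSYmem_of _ (fun hw => ?_) (fun ht => ?_), ZMod.val_natCast_of_lt hvp⟩
          · have := (hMc v).2 ⟨_, hw, ZMod.val_natCast_of_lt hvp⟩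
            rw [hcv] at this; exact Bool.noConfusion this
          · have := (hMt v).2 ⟨_, ht, ZMod.val_natCast_of_lt hvp⟩
            rw [htv] at this; exact Bool.noConfusion this
        · rw [hcv, htv] at hv'; exact absurd hv' (by decide)
      · cases htv : tb Mt v
        · rw [hcv, htv] at hv'; exact absurd hv' (by decide)
        · exfalso
          obtain ⟨e, he, hev⟩ := (hMc v).1 hcv
          obtain ⟨e', he', hev'⟩ := (hMt v).1 htv
          have : e' = e := ZMod.val_injective p (by rw [hev, hev'])
          rw [this] at he'
          exact Finset.disjoint_left.1 hTWSY he' (mem_union_left _ he)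
    · rintro ⟨e, he, rfl⟩
      have hW' : tb Mc e.val = false := by
        cases hcv : tb Mc e.val
        · rfl
        · obtain ⟨e', he', hev'⟩ := (hMc _).1 hcv
          rw [ZMod.val_injective p hev'] at he'
          exact absurd he (Finset.disjoint_left.1 hWSY he')
      have hT' : tb Mt e.val = false := by
        cases htv : tb Mt e.val
        · rfl
        · obtain ⟨e', he', hev'⟩ := (hMt _).1 htv
          rw [ZMod.val_injective p hev'] at he'
          exact absurd (mem_union_right _ he) (Finset.disjoint_left.1 hTWSY he')
      rw [hW', hT']; rfl
  · rw [tb_eq_false_of_lt hsy_lt (by omega)]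
    constructor
    · intro h'; exact Bool.noConfusion h'
    · rintro ⟨e, _, hev⟩; have := e.val_lt; omega

end Summit.MatrixMultiplication.OmegaCensus.CubeNB.S2
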